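import Literature.MathematicalPhysics.QuantumFieldTheory.Balaban1983to89.B2Eq227CondDelta

/-!
# Bałaban, *(Higgs)₂,₃ quantum fields in a finite volume I*, CMP **85** (1982): the inductive step (2.18) FOR THE MODEL —
one renormalization transformation of `exp(−½⟨φ, Δ^{(k),L^kε}(Ω,A)φ⟩)` on the (Higgs)₂,₃ carrier, general external field

p. 610, verbatim: *"We define inductively Δ^{(0),ε}(Ω, A) = −Δ^{ε,N}_{A,Ω} + m², (2.17)
Z^{(k),L^kε}(Ω, A) exp(−½⟨ψ, Δ^{(k+1),L^{k+1}ε}(Ω, A)ψ⟩) = T^{L^kε}_{a,L,A}[Ω^{(k)}, exp(−½⟨φ, Δ^{(k),L^kε}(Ω, A)φ⟩)]. (2.18)"* …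
*"Defining the propagator (2.20) and calculating the integral in (2.19), we obtain
⟨ψ, Δ^{(k),L^kε}(Ω, A)ψ⟩ = a_k(L^kε)^{−2}⟨ψ, ψ⟩ − a_k²(L^kε)^{−4}⟨ψ, Q_k(A)G^ε_k(Ω, A)Q^*_k(A)ψ⟩. (2.21)"*

WHAT THIS FILE PROVES (kernel theorems; no `def … : Prop`).  The tree DEFINES `Δ^{(k),L^kε}(Ω,A)` by the solved form (2.21)
(p35's `B1Eq230FluctCov.deltaKA`, (2.17) at `k = 0`) and had the Gaussian computation behind (2.18)/(2.19) on GENERIC carriers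
(p34's `B1Eq221GaussStep.rtOp_gaussDensity_eq_of_isStationary`, the schematic `B1Eq221Dictionary.display218`) and on pieces
(`B2Eq328ConcretePieces.eq219_piece`).  Here (2.18) is proved AS PRINTED for the model's own transformation
`HiggsAveraging.renormTransf` ((2.4)–(2.6) at `Ω = T^{(k)}`, kernel precision `a(L^{k+1}ε)^{d−2}`, covariant average `Q(A)`):
* `eq218_model`: `T^{L^kε}_{a,L,A}[exp(−½⟨φ,Δ^{(k),L^kε}(Ω,A)φ⟩)](ψ) = Z^{(k)}·exp(−½⟨ψ, Δ^{(k+1)}_{T}ψ⟩)` with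
  `Z^{(k)} = T[…](0)` and `Δ^{(k+1)}_{T} = a(L^{k+1}ε)^{−2}·1 − a²(L^{k+1}ε)^{−4}·Q(A)C^{(k),L^kε}(Ω,A)Q^*(A)` (the typer's
  `B2Eq227CondDelta.condDelta227 … Finset.univ`, the one-step Schur complement), every `k ≤ K`, `m² > 0`, `a > 0`, `L > 1`;
* `eq218_model_221`: the same with the right side `exp(−½⟨ψ, Δ^{(k+1),L^{k+1}ε}(Ω,A)ψ⟩)`, `Δ^{(k+1)}` = `deltaKA (k+1)` — the
  printed (2.18) with (2.21) — for `k < K` (the typer's `condDelta227_univ_eq_deltaKA`, i.e. b2b's `display221_succ` on p35's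
  `stepData`, supplies `Δ^{(k+1)}_{T} = Δ^{(k+1),L^{k+1}ε}`);
* `renormTransf_gauss_zero_pos`: `Z^{(k),L^kε}(Ω,A) > 0` (the normalising constant of (2.18) is a genuine positive number;
  `jointA_self_eq`: the φφ-form of the exponent is `⟨φ,(a(L^{k+1}ε)^{−2}P(A) + Δ^{(k)})φ⟩`, p. 611's definition of
  `C^{(k),L^kε}` *"by means of the quadratic form in φ in this integral"*); `eq218_model_normalised`: `T[…](ψ)/Z^{(k)} =
  exp(−½⟨ψ,Δ^{(k+1),L^{k+1}ε}(Ω,A)ψ⟩)`.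
* (v1.1) **(2.19) for the model**: `eq219_model` — `T^ε_{a_k,L^k,A}[exp(−½⟨φ,(−Δ^{ε,N}_{A,Ω} + m²)φ⟩)](ψ) = Z^ε_k·exp(−½⟨ψ,
  Δ^{(k),L^kε}(Ω,A)ψ⟩)` for the model's `k`-th order transformation `HiggsAveraging.renormTransfK` (kernel (2.10)), `k ≥ 1`, with
  `Δ^{(k)}` THE SOLVED FORM (2.21) = p35's `deltaKA k` directly («calculating the integral in (2.19), we obtain (2.21)» as a kernel
  theorem; stationary point `statPtK` = `φ^{(k),ε}` of (3.29)); `renormTransfK_gauss_zero_pos`: `Z^ε_k(Ω,A) > 0`.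
The proof is the printed one (pp. 613–614, (3.10)–(3.11)): translation by the stationary point
`φ^{(k)} = a(L^{k+1}ε)^{−2}C^{(k)}Q^*ψ` (`statPt`, `isStationary_statPt`), the value of the exponent at the stationary point
is `⟨ψ, Δ^{(k+1)}_{T}ψ⟩` (`schurForm_statPt`); the bookkeeping `a(L^{k+1}ε)^{d−2}·Σ_y = a(L^{k+1}ε)^{−2}·⟨·,·⟩_{T^{(k+1)}}`
between the kernel (2.6) and the scalar product (1.5) is `prec_mul_sum_inner`.
HONEST SCOPE.  `Ω ⊂ T_ε` enters only through `Δ^{(k),L^kε}(Ω,A)` (p35's operators act on all fields of `T^{(k)}`, bonds outside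
`Ω` dropped, mass everywhere); the transformation is the `Ω^{(k)} = T^{(k)}` one of `HiggsAveraging` (p. 610: *"In this paper
we will use the case Ω = T_ε only"*); nothing quantitative.  Serves row B1.Eq2.17 of `ROWS-B1.md` ((2.18) as a kernel
theorem for the model).  Unit `lit-balaban-r14` gen 22 (literature-prover-lit-balaban-r14-g22-0); HOME/FILED.md records the
proposal.  Statement-level skeleton of published theorems with citation tags; proofs where landed; nothing here is a claim
about the Yang–Mills mass gap.
-/

open scoped BigOperators InnerProductSpace

namespace Literature.MathematicalPhysics.QuantumFieldTheory.Balaban1983to89.B1Eq218Model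

open Literature.MathematicalPhysics.QuantumFieldTheory.Balaban1983to89.HiggsLattice
open Literature.MathematicalPhysics.QuantumFieldTheory.Balaban1983to89.HiggsAveraging
open Literature.MathematicalPhysics.QuantumFieldTheory.Balaban1983to89.HiggsCovariance
open Literature.MathematicalPhysics.QuantumFieldTheory.Balaban1983to89.HiggsCovariancePos
open Literature.MathematicalPhysics.QuantumFieldTheory.Balaban1983to89.HiggsFluctMeasure
open Literature.MathematicalPhysics.QuantumFieldTheory.Balaban1983to89.HiggsFluctMeasurePos
open Literature.MathematicalPhysics.QuantumFieldTheory.Balaban1983to89.B1Eq27StepAdjoint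
open Literature.MathematicalPhysics.QuantumFieldTheory.Balaban1983to89.B1Eq230FluctCov
open Literature.MathematicalPhysics.QuantumFieldTheory.Balaban1983to89.B1Eq230FluctCovPos
open Literature.MathematicalPhysics.QuantumFieldTheory.Balaban1983to89.B2Eq227CondDelta
open Literature.MathematicalPhysics.QuantumFieldTheory.Balaban1983to89.B1Eq221GaussStep

variable {P : HiggsLattice.Params} {N : ℕ}

section Forms

variable (C : ChargeData N) (Ω : Finset (HiggsLattice.Site P 0)) (A : HiggsLattice.VecField P 0) (msq a : ℝ)

/-- The quadratic form `⟨φ, Δ^{(j),L^jε}(Ω,A)χ⟩_{T^{(j)}}` of the density in (2.18) as a bilinear map (scalar product (1.5),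
operator = p35's `deltaKA`). [cite: Balaban1982Higgs1, (2.18) p.610] -/
noncomputable def deltaForm (j : ℕ) : ScalarField P j N →ₗ[ℝ] ScalarField P j N →ₗ[ℝ] ℝ :=
  LinearMap.mk₂ ℝ (fun φ χ => siteInner φ (deltaKA C Ω A msq a j χ))
    (fun φ φ' χ => by
      show siteInner (φ + φ') _ = siteInner φ _ + siteInner φ' _
      rw [siteInner_comm, siteInner_add_right, siteInner_comm, siteInner_comm (deltaKA C Ω A msq a j χ)])
    (fun c φ χ => by
      show siteInner (c • φ) _ = c • siteInner φ _
      rw [siteInner_smul_left, smul_eq_mul])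
    (fun φ χ χ' => by
      show siteInner φ (deltaKA C Ω A msq a j (χ + χ')) = siteInner φ _ + siteInner φ _
      rw [map_add, siteInner_add_right])
    (fun c φ χ => by
      show siteInner φ (deltaKA C Ω A msq a j (c • χ)) = c • siteInner φ _
      rw [map_smul, siteInner_smul_right, smul_eq_mul])

/-- Unfolding. [cite: Balaban1982Higgs1, (2.18) p.610] -/
theorem deltaForm_apply (j : ℕ) (φ χ : ScalarField P j N) :
    deltaForm C Ω A msq a j φ χ = siteInner φ (deltaKA C Ω A msq a j χ) := rfl

/-- The form of `Δ^{(j)}` is symmetric (p35's `siteInner_deltaKA_comm`). [cite: Balaban1982Higgs1, (2.21) p.610] -/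
theorem deltaForm_symm (j : ℕ) (φ χ : ScalarField P j N) :
    deltaForm C Ω A msq a j φ χ = deltaForm C Ω A msq a j χ φ := by
  rw [deltaForm_apply, deltaForm_apply]
  exact siteInner_deltaKA_comm C Ω A msq a j φ χ

/-- The density transformed in (2.18), `exp(−½⟨φ, Δ^{(j),L^jε}(Ω,A)φ⟩)`, is p34's `gaussDensity` of `deltaForm` (definitional).
[cite: Balaban1982Higgs1, (2.18) p.610] -/
theorem gauss_eq (j : ℕ) :
    (fun φ : ScalarField P j N => Real.exp (-(1 / 2 : ℝ) * siteInner φ (deltaKA C Ω A msq a j φ)))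
      = gaussDensity (deltaForm C Ω A msq a j) := rfl

/-- The kernel of the model's one-step transformation IS p34's `blockKernel` at the printed precision `a(L^{j+1}ε)^{d−2}` and
the LINEAR map `Q(A)` (`B1Eq27StepAdjoint.avgQLin`; `HiggsAveraging.rtKernelStep` carries the function `avgQ`).
[cite: Balaban1982Higgs1, (2.5)–(2.6) p.608] -/
theorem rtKernelStep_eq (j : ℕ) :
    rtKernelStep (k := j) C a A
      = B1RT.blockKernel (B1RT.prec a (P.mesh (j + 1)) P.d)
          (fun φ : ScalarField P j N => (avgQLin C A j φ : ScalarField P (j + 1) N)) := by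
  unfold rtKernelStep
  congr 1
  funext φ
  exact (avgQLin_coe C A j φ).symm

/-- **The weight bookkeeping**: `a(L^{j+1}ε)^{d−2}·Σ_y f(y)·g(y) = a(L^{j+1}ε)^{−2}·⟨f, g⟩_{T^{(j+1)}}` — the kernel constant of
(2.6) against the scalar product (1.5) on `T^{(j+1)}` (weight `(L^{j+1}ε)^d`; the typer's `stepCoef_mul_mesh_pow`).
[cite: Balaban1982Higgs1, (1.5) p.604, (2.6) p.608] -/
theorem prec_mul_sum_inner (j : ℕ) (f g : ScalarField P (j + 1) N) :
    B1RT.prec a (P.mesh (j + 1)) P.d * ∑ y, ⟪f y, g y⟫_ℝ = stepCoef P a j * siteInner f g := by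
  rw [← stepCoef_mul_mesh_pow, siteInner, Finset.mul_sum, Finset.mul_sum]
  exact Finset.sum_congr rfl fun y _ => by ring

/-- **The stationary point (3.10)/(3.29) of the exponent of (2.18)**: `φ^{(j)} = a(L^{j+1}ε)^{−2}·C^{(j),L^jε}(Ω,A)Q^*(A)ψ`
(p. 614: *"B^{(1)} = aL^{−2}C^{(0)}Q^*B"*). [cite: Balaban1982Higgs1, (3.10) p.614] -/
noncomputable def statPt (j : ℕ) (ψ : ScalarField P (j + 1) N) : ScalarField P j N :=
  fluctCovA C Ω A msq a j (stepCoef P a j • avgQAdjLin C A j ψ)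

/-- `Q(A)φ^{(j)} = a(L^{j+1}ε)^{−2}·Q(A)C^{(j)}Q^*(A)ψ`. [cite: Balaban1982Higgs1, (3.10) p.614] -/
theorem avgQLin_statPt (j : ℕ) (ψ : ScalarField P (j + 1) N) :
    avgQLin C A j (statPt C Ω A msq a j ψ)
      = stepCoef P a j • avgQLin C A j (fluctCovA C Ω A msq a j (avgQAdjLin C A j ψ)) := by
  rw [statPt, map_smul, map_smul]

/-- **`φ^{(j)}` IS a stationary point** of `½a(L^{j+1}ε)^{d−2}Σ_y|ψ(y) − (Q(A)φ)(y)|² + ½⟨φ, Δ^{(j)}φ⟩` in `φ` (the Euler–Lagrange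
equation `(a(L^{j+1}ε)^{−2}P(A) + Δ^{(j)})φ^{(j)} = a(L^{j+1}ε)^{−2}Q^*(A)ψ` in weak form — p. 614 *"simple transformations
connected with the translation (3.10) give (3.11)"*): `m² > 0`, `a > 0`, `L > 1`, `j ≤ K` (*"It is so"*,
`B1Eq230FluctCovPos.isUnit_precOpA_of_le`). PROVED. [cite: Balaban1982Higgs1, (3.10)–(3.11) p.614] -/
theorem isStationary_statPt {msq a : ℝ} (hmsq : 0 < msq) (ha : 0 < a) (hL : 1 < (P.L : ℝ)) {j : ℕ} (hj : j ≤ P.K)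
    (ψ : ScalarField P (j + 1) N) :
    IsStationary (B1RT.prec a (P.mesh (j + 1)) P.d) (avgQLin C A j) (deltaForm C Ω A msq a j) ψ
      (statPt C Ω A msq a j ψ) := by
  intro χ
  have hU := isUnit_precOpA_of_le C Ω A hmsq ha hL hj
  unfold jointA source
  rw [prec_mul_sum_inner, prec_mul_sum_inner, deltaForm_apply, ← siteInner_blockProjA_eq]
  have h1 : stepCoef P a j * siteInner (statPt C Ω A msq a j ψ) (blockProjA C A j χ)
        + siteInner (statPt C Ω A msq a j ψ) (deltaKA C Ω A msq a j χ)
      = siteInner (statPt C Ω A msq a j ψ) (precOpA C Ω A msq a j χ) := by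
    rw [precOpA_eq, LinearMap.add_apply, LinearMap.smul_apply, siteInner_add_right, siteInner_smul_right]
  rw [h1, siteInner_precOpA_comm, statPt, precOpA_fluctCovA_apply C Ω A hU, siteInner_smul_right, siteInner_comm,
    siteInner_avgQAdjLin]

/-- **The value of the exponent at the stationary point is `⟨ψ, Δ^{(j+1)}_{T}ψ⟩`**: p34's `schurForm` at `φ^{(j)}` equals
`a(L^{j+1}ε)^{−2}⟨ψ,ψ⟩ − a²(L^{j+1}ε)^{−4}⟨ψ, Q(A)C^{(j)}(Ω,A)Q^*(A)ψ⟩ = ⟨ψ, Δ^{(j+1)}_{T^{(j)}}(Ω,A)ψ⟩` (the typer's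
`condDelta227 … Finset.univ`, II (2.27) without conditioning = the one-step Schur complement). PROVED.
[cite: Balaban1982Higgs1, (2.18) p.610, (2.21) p.610] -/
theorem schurForm_statPt (j : ℕ) (ψ : ScalarField P (j + 1) N) :
    schurForm (B1RT.prec a (P.mesh (j + 1)) P.d) (avgQLin C A j) ψ (statPt C Ω A msq a j ψ)
      = siteInner ψ (condDelta227 C Ω A msq a j Finset.univ ψ) := by
  unfold schurForm source
  have hn : ∑ y, ‖ψ y‖ ^ 2 = ∑ y, ⟪ψ y, ψ y⟫_ℝ :=
    Finset.sum_congr rfl fun y _ => (real_inner_self_eq_norm_sq (ψ y)).symm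
  rw [hn, prec_mul_sum_inner, prec_mul_sum_inner, avgQLin_statPt, siteInner_smul_right, condDelta227_univ]
  simp only [LinearMap.sub_apply, LinearMap.smul_apply, LinearMap.comp_apply, Module.End.one_apply,
    siteInner_sub_right, siteInner_smul_right]
  ring

end Forms

section Step

variable (C : ChargeData N) (Ω : Finset (HiggsLattice.Site P 0)) (A : HiggsLattice.VecField P 0)

/-- **(2.18) FOR THE MODEL** (general external field `A`, every `Ω`, level `j ≤ K`; `m² > 0`, `a > 0`, `L > 1`):
`T^{L^jε}_{a,L,A}[exp(−½⟨φ, Δ^{(j),L^jε}(Ω,A)φ⟩)](ψ) = Z^{(j),L^jε}(Ω,A)·exp(−½⟨ψ, Δ^{(j+1)}_{T}ψ⟩)`, where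
`Z^{(j),L^jε}(Ω,A) := T^{L^jε}_{a,L,A}[…](0)` (the normalising constant that (2.18) defines) and
`Δ^{(j+1)}_{T} = a(L^{j+1}ε)^{−2}·1 − a²(L^{j+1}ε)^{−4}·Q(A)C^{(j),L^jε}(Ω,A)Q^*(A)` (`condDelta227 … Finset.univ`).  Proof = the
printed one: translation (3.10) by `statPt` under `∫dφ` and (3.11) (`B1Eq221GaussStep.rtOp_gaussDensity_eq_of_isStationary`).
PROVED. [cite: Balaban1982Higgs1, (2.18) p.610, (3.10)–(3.11) p.614] -/
theorem eq218_model {msq a : ℝ} (hmsq : 0 < msq) (ha : 0 < a) (hL : 1 < (P.L : ℝ)) {j : ℕ} (hj : j ≤ P.K)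
    (ψ : ScalarField P (j + 1) N) :
    renormTransf C a A (fun φ : ScalarField P j N => Real.exp (-(1 / 2 : ℝ) * siteInner φ (deltaKA C Ω A msq a j φ))) ψ
      = renormTransf C a A
          (fun φ : ScalarField P j N => Real.exp (-(1 / 2 : ℝ) * siteInner φ (deltaKA C Ω A msq a j φ))) 0
        * Real.exp (-(1 / 2 : ℝ) * siteInner ψ (condDelta227 C Ω A msq a j Finset.univ ψ)) := by
  unfold renormTransf
  rw [rtKernelStep_eq, gauss_eq, ← schurForm_statPt C Ω A msq a j ψ]
  exact rtOp_gaussDensity_eq_of_isStationary (deltaForm_symm C Ω A msq a j)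
    (isStationary_statPt C Ω A hmsq ha hL hj ψ)

/-- **(2.18) WITH (2.21) FOR THE MODEL** (`j < K`): `T^{L^jε}_{a,L,A}[exp(−½⟨φ, Δ^{(j),L^jε}(Ω,A)φ⟩)](ψ)
= Z^{(j),L^jε}(Ω,A)·exp(−½⟨ψ, Δ^{(j+1),L^{j+1}ε}(Ω,A)ψ⟩)` with `Δ^{(j+1),L^{j+1}ε}(Ω,A)` THE SOLVED FORM (2.21) at `j + 1`
(p35's `deltaKA (j+1)`): the inductive definition (2.18) and «calculating the integral … we obtain (2.21)» agree on the
model (the typer's `B2Eq227CondDelta.condDelta227_univ_eq_deltaKA` = b2b's `display221_succ` on p35's `stepData`). PROVED.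
[cite: Balaban1982Higgs1, (2.18) p.610, (2.21) p.610] -/
theorem eq218_model_221 {msq a : ℝ} (hmsq : 0 < msq) (ha : 0 < a) (hL : 1 < (P.L : ℝ)) {j : ℕ} (hjK : j < P.K)
    (ψ : ScalarField P (j + 1) N) :
    renormTransf C a A (fun φ : ScalarField P j N => Real.exp (-(1 / 2 : ℝ) * siteInner φ (deltaKA C Ω A msq a j φ))) ψ
      = renormTransf C a A
          (fun φ : ScalarField P j N => Real.exp (-(1 / 2 : ℝ) * siteInner φ (deltaKA C Ω A msq a j φ))) 0
        * Real.exp (-(1 / 2 : ℝ) * siteInner ψ (deltaKA C Ω A msq a (j + 1) ψ)) := by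
  rw [eq218_model C Ω A hmsq ha hL hjK.le ψ, condDelta227_univ_eq_deltaKA C Ω A hmsq ha hL hjK]

/-- The φφ-part of the exponent of (2.18) is the form of the operator of (2.30):
`a(L^{j+1}ε)^{d−2}Σ_y|(Q(A)φ)(y)|² + ⟨φ, Δ^{(j)}φ⟩ = ⟨φ, (a(L^{j+1}ε)^{−2}P(A) + Δ^{(j),L^jε}(Ω,A))φ⟩` (p. 611: *"We define a
covariance C^{(k),L^kε}(Ω, A) by means of the quadratic form in φ in this integral"*). PROVED. [cite: Balaban1982Higgs1, (2.30) p.611] -/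
theorem jointA_self_eq (msq a : ℝ) (j : ℕ) (φ : ScalarField P j N) :
    jointA (B1RT.prec a (P.mesh (j + 1)) P.d) (avgQLin C A j) (deltaForm C Ω A msq a j) φ φ
      = siteInner φ (precOpA C Ω A msq a j φ) := by
  unfold jointA
  rw [prec_mul_sum_inner, deltaForm_apply, ← siteInner_blockProjA_eq, precOpA_eq, LinearMap.add_apply,
    LinearMap.smul_apply, siteInner_add_right, siteInner_smul_right]

/-- **`Z^{(j),L^jε}(Ω, A) > 0`**: the normalising constant defined by (2.18) is a positive real number (the integrand is a
non-degenerate Gaussian: its φφ-form is that of the invertible operator of (2.30), `B1Eq230FluctCovPos.siteInner_precOpA_pos`;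
closed form p34's `B1Eq221Coordinates.normConst_eq_zConst`, positivity p15's `zConst_pos`); `m² > 0`, `a > 0`, `L > 1`,
`j ≤ K`. PROVED. [cite: Balaban1982Higgs1, (2.18) p.610, (3.31)–(3.32) p.617] -/
theorem renormTransf_gauss_zero_pos {msq a : ℝ} (hmsq : 0 < msq) (ha : 0 < a) (hL : 1 < (P.L : ℝ)) {j : ℕ}
    (hj : j ≤ P.K) :
    0 < renormTransf C a A
      (fun φ : ScalarField P j N => Real.exp (-(1 / 2 : ℝ) * siteInner φ (deltaKA C Ω A msq a j φ))) 0 := by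
  have hpos : ∀ φ : ScalarField P j N, φ ≠ 0 →
      0 < jointA (B1RT.prec a (P.mesh (j + 1)) P.d) (avgQLin C A j) (deltaForm C Ω A msq a j) φ φ := by
    intro φ hφ
    rw [jointA_self_eq]
    exact siteInner_precOpA_pos C Ω A hmsq ha hL hj hφ
  have hκ : 0 < B1RT.prec a (P.mesh (j + 1)) P.d := B1RT.prec_pos ha (P.mesh_pos (j + 1)) P.d
  unfold renormTransf
  rw [rtKernelStep_eq, gauss_eq, ← B1Eq239Normalization.normConst_eq,
    B1Eq221Coordinates.normConst_eq_zConst hκ.le (deltaForm_symm C Ω A msq a j) hpos]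
  exact B1Eq239Normalization.zConst_pos hκ _
    (B1Eq221Coordinates.posDef_coordA (deltaForm_symm C Ω A msq a j) hpos)

/-- Hence the normalised transformed density is EXACTLY the Gaussian of `Δ^{(j+1),L^{j+1}ε}(Ω,A)`:
`T[exp(−½⟨φ,Δ^{(j)}φ⟩)](ψ) / Z^{(j)} = exp(−½⟨ψ, Δ^{(j+1)}ψ⟩)` — the content of «We define inductively» (2.18) read as a
theorem about the model's operators (`j < K`). PROVED. [cite: Balaban1982Higgs1, (2.18) p.610] -/
theorem eq218_model_normalised {msq a : ℝ} (hmsq : 0 < msq) (ha : 0 < a) (hL : 1 < (P.L : ℝ)) {j : ℕ} (hjK : j < P.K)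
    (ψ : ScalarField P (j + 1) N) :
    renormTransf C a A (fun φ : ScalarField P j N => Real.exp (-(1 / 2 : ℝ) * siteInner φ (deltaKA C Ω A msq a j φ))) ψ
        / renormTransf C a A
            (fun φ : ScalarField P j N => Real.exp (-(1 / 2 : ℝ) * siteInner φ (deltaKA C Ω A msq a j φ))) 0
      = Real.exp (-(1 / 2 : ℝ) * siteInner ψ (deltaKA C Ω A msq a (j + 1) ψ)) := by
  rw [eq218_model_221 C Ω A hmsq ha hL hjK ψ,
    mul_div_cancel_left₀ _ (renormTransf_gauss_zero_pos C Ω A hmsq ha hL hjK.le).ne']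

end Step

/-! ## (v1.1) (2.19) FOR THE MODEL: the `k`-th order transformation of the basic Gaussian density -/

section Nineteen

variable (C : ChargeData N) (Ω : Finset (HiggsLattice.Site P 0)) (A : HiggsLattice.VecField P 0) (msq a : ℝ)

/-- **The weight bookkeeping for the `k`-th order kernel (2.10)**: `a_k(L^kε)^{d−2}·Σ_y f(y)·g(y) = a_k(L^kε)^{−2}·⟨f, g⟩_{T^{(k)}}`
(`a_k(L^kε)^{−2}` = `HiggsFluctMeasure.coeff221`; p15's `B2Eq328DeltaK.precAt_eq` is the same identity). [cite: Balaban1982Higgs1, (1.5) p.604, (2.10) p.609] -/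
theorem precK_mul_sum_inner (k : ℕ) (f g : ScalarField P k N) :
    B1RT.prec (B1.aSeq a P.L k) (P.mesh k) P.d * ∑ y, ⟪f y, g y⟫_ℝ = coeff221 P a k * siteInner f g := by
  have hℓ : P.mesh k ≠ 0 := (P.mesh_pos k).ne'
  have hp : B1RT.prec (B1.aSeq a P.L k) (P.mesh k) P.d = coeff221 P a k * P.mesh k ^ P.d := by
    rw [B1RT.prec_eq, coeff221_eq, zpow_sub₀ hℓ, zpow_natCast, inv_pow, mul_assoc]
    congr 1
    rw [div_eq_mul_inv, mul_comm, zpow_ofNat]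
  rw [hp, siteInner, Finset.mul_sum, Finset.mul_sum]
  exact Finset.sum_congr rfl fun y _ => by ring

/-- The kernel (2.10) of the model's `k`-th order transformation IS p34's `blockKernel` at the precision `a_k(L^kε)^{d−2}` and the
LINEAR map `Q_k(A)` (`HiggsCovariance.avgQkLin`; `HiggsAveraging.rtKernelK` carries the function `avgQk`). [cite: Balaban1982Higgs1, (2.10) p.609] -/
theorem rtKernelK_eq (k : ℕ) :
    rtKernelK C a A k
      = B1RT.blockKernel (B1RT.prec (B1.aSeq a P.L k) (P.mesh k) P.d)
          (fun φ : ScalarField P 0 N => (avgQkLin C A k φ : ScalarField P k N)) := by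
  unfold rtKernelK
  congr 1
  funext φ
  funext y
  exact (avgQkLin_apply C A k φ y).symm

/-- **The configuration `φ^{(k),ε} = a_k(L^kε)^{−2}G^ε_k(Ω,A)Q^*_k(A)ψ` of (3.29)** — the stationary point of the exponent of (2.19).
[cite: Balaban1982Higgs1, (3.29) p.617] -/
noncomputable def statPtK (k : ℕ) (ψ : ScalarField P k N) : ScalarField P 0 N :=
  propagatorK C Ω A msq a k (coeff221 P a k • avgQkAdj C A k ψ)

/-- **`φ^{(k),ε}` IS a stationary point** of `½a_k(L^kε)^{d−2}Σ_y|ψ(y) − (Q_k(A)φ)(y)|² + ½⟨φ,(−Δ^{ε,N}_{A,Ω} + m²)φ⟩` in `φ`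
(Euler–Lagrange equation `(−Δ^{ε,N}_{A,Ω} + m² + a_k(L^kε)^{−2}P_k(A))φ^{(k)} = a_k(L^kε)^{−2}Q^*_k(A)ψ`, i.e. «Defining the propagator
(2.20)»); `m² > 0`, `a_k ≥ 0`. PROVED. [cite: Balaban1982Higgs1, (2.19)–(2.20) p.610, (3.29) p.617] -/
theorem isStationary_statPtK {msq : ℝ} (hmsq : 0 < msq) (a : ℝ) (k : ℕ) (hak : 0 ≤ B1.aSeq a P.L k)
    (ψ : ScalarField P k N) :
    IsStationary (B1RT.prec (B1.aSeq a P.L k) (P.mesh k) P.d) (avgQkLin C A k) (deltaForm C Ω A msq a 0) ψ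
      (statPtK C Ω A msq a k ψ) := by
  intro χ
  unfold jointA source
  rw [precK_mul_sum_inner, precK_mul_sum_inner, deltaForm_apply, deltaKA_zero, ← siteInner_projPk_eq]
  have h1 : coeff221 P a k * siteInner (statPtK C Ω A msq a k ψ) (avgQkAdj C A k (avgQkLin C A k χ))
        + siteInner (statPtK C Ω A msq a k ψ) (delta0 C Ω A msq χ)
      = siteInner (statPtK C Ω A msq a k ψ) (covOpK C Ω A msq a k χ) := by
    rw [covOpK_eq_coeff221]
    simp only [delta0, LinearMap.add_apply, LinearMap.smul_apply, LinearMap.id_apply, LinearMap.comp_apply,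
      siteInner_add_right, siteInner_smul_right]
    ring
  rw [h1, siteInner_covOpK_comm, statPtK, covOpK_propagatorK_apply C Ω A hmsq a k hak, siteInner_smul_right,
    ← siteInner_avgQkLin, siteInner_comm]

/-- **The value of the exponent of (2.19) at `φ^{(k),ε}` is `⟨ψ, Δ^{(k),L^kε}(Ω,A)ψ⟩` with `Δ^{(k)}` THE SOLVED FORM (2.21)**
(`a_k(L^kε)^{−2}⟨ψ,ψ⟩ − a_k²(L^kε)^{−4}⟨ψ, Q_kG^ε_kQ^*_kψ⟩` = p35's `deltaKA (j+1)`), `k ≥ 1`. PROVED. [cite: Balaban1982Higgs1, (2.21) p.610] -/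
theorem schurForm_statPtK (j : ℕ) (ψ : ScalarField P (j + 1) N) :
    schurForm (B1RT.prec (B1.aSeq a P.L (j + 1)) (P.mesh (j + 1)) P.d) (avgQkLin C A (j + 1)) ψ
        (statPtK C Ω A msq a (j + 1) ψ)
      = siteInner ψ (deltaKA C Ω A msq a (j + 1) ψ) := by
  unfold schurForm source
  have hn : ∑ y, ‖ψ y‖ ^ 2 = ∑ y, ⟪ψ y, ψ y⟫_ℝ :=
    Finset.sum_congr rfl fun y _ => (real_inner_self_eq_norm_sq (ψ y)).symm
  rw [hn, precK_mul_sum_inner, precK_mul_sum_inner, statPtK, map_smul, map_smul, siteInner_smul_right, deltaKA_succ]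
  simp only [LinearMap.sub_apply, LinearMap.smul_apply, LinearMap.id_apply, LinearMap.comp_apply,
    siteInner_sub_right, siteInner_smul_right]
  ring

/-- **(2.19) FOR THE MODEL** (general `A`, every `Ω`, `k ≥ 1`, `m² > 0`, `a > 0`, `L > 1`): *"From (2.16) we have
Z^ε_k(Ω, A) exp(−½⟨ψ, Δ^{(k),L^kε}(Ω, A)ψ⟩) = T^ε_{a_k,L^k,A}[Ω, exp(−½⟨φ, (−Δ^{ε,N}_{A,Ω} + m²)φ⟩)]"* — for the model's own
`k`-th order transformation `HiggsAveraging.renormTransfK` ((2.4)–(2.5) with the kernel (2.10), `Ω = T_ε`), with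
`Z^ε_k(Ω,A) := T^ε_{a_k,L^k,A}[…](0)` and `Δ^{(k),L^kε}(Ω,A)` = THE SOLVED FORM (2.21) (p35's `deltaKA k`): «calculating the integral in
(2.19), we obtain (2.21)» as a kernel theorem on the (Higgs)₂,₃ carrier (p34's generic computation at the stationary point (3.29)).
PROVED. [cite: Balaban1982Higgs1, (2.19)–(2.21) p.610, (3.29) p.617] -/
theorem eq219_model {msq a : ℝ} (hmsq : 0 < msq) (ha : 0 < a) (hL : 1 < (P.L : ℝ)) {k : ℕ} (hk : 1 ≤ k)
    (ψ : ScalarField P k N) :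
    renormTransfK C a A k (fun φ : ScalarField P 0 N => Real.exp (-(1 / 2 : ℝ) * siteInner φ (delta0 C Ω A msq φ))) ψ
      = renormTransfK C a A k
          (fun φ : ScalarField P 0 N => Real.exp (-(1 / 2 : ℝ) * siteInner φ (delta0 C Ω A msq φ))) 0
        * Real.exp (-(1 / 2 : ℝ) * siteInner ψ (deltaKA C Ω A msq a k ψ)) := by
  obtain ⟨j, rfl⟩ : ∃ j, k = j + 1 := ⟨k - 1, by omega⟩
  have hak : 0 ≤ B1.aSeq a P.L (j + 1) := (B1.aSeq_pos ha hL hk).le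
  have hg : (fun φ : ScalarField P 0 N => Real.exp (-(1 / 2 : ℝ) * siteInner φ (delta0 C Ω A msq φ)))
      = gaussDensity (deltaForm C Ω A msq a 0) := by
    funext φ
    rw [gaussDensity, deltaForm_apply, deltaKA_zero]
  unfold renormTransfK
  rw [rtKernelK_eq, hg, ← schurForm_statPtK C Ω A msq a j ψ]
  exact rtOp_gaussDensity_eq_of_isStationary (deltaForm_symm C Ω A msq a 0)
    (isStationary_statPtK C Ω A hmsq a (j + 1) hak ψ)

/-- **`Z^ε_k(Ω, A) > 0`** (the (2.19) normalising constant; its closed form is (3.31)/(3.32)): the φφ-form of the exponent is that of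
the invertible operator of (2.20) (`HiggsCovariancePos.siteInner_covOpK_ge`), so p34's `normConst_eq_zConst` and p15's `zConst_pos`
apply; `m² > 0`, `a > 0`, `L > 1`, `k ≥ 1`. PROVED. [cite: Balaban1982Higgs1, (2.19) p.610, (3.31)–(3.32) p.617] -/
theorem renormTransfK_gauss_zero_pos {msq a : ℝ} (hmsq : 0 < msq) (ha : 0 < a) (hL : 1 < (P.L : ℝ)) {k : ℕ} (hk : 1 ≤ k) :
    0 < renormTransfK C a A k
      (fun φ : ScalarField P 0 N => Real.exp (-(1 / 2 : ℝ) * siteInner φ (delta0 C Ω A msq φ))) 0 := by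
  have hak : 0 ≤ B1.aSeq a P.L k := (B1.aSeq_pos ha hL hk).le
  have hpos : ∀ φ : ScalarField P 0 N, φ ≠ 0 →
      0 < jointA (B1RT.prec (B1.aSeq a P.L k) (P.mesh k) P.d) (avgQkLin C A k) (deltaForm C Ω A msq a 0) φ φ := by
    intro φ hφ
    have hj : jointA (B1RT.prec (B1.aSeq a P.L k) (P.mesh k) P.d) (avgQkLin C A k) (deltaForm C Ω A msq a 0) φ φ
        = siteInner φ (covOpK C Ω A msq a k φ) := by
      unfold jointA
      rw [precK_mul_sum_inner, deltaForm_apply, deltaKA_zero, ← siteInner_projPk_eq, covOpK_eq_coeff221]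
      simp only [delta0, LinearMap.add_apply, LinearMap.smul_apply, LinearMap.id_apply, LinearMap.comp_apply,
        siteInner_add_right, siteInner_smul_right]
      ring
    rw [hj]
    have hge := siteInner_covOpK_ge C Ω A msq a k hak φ
    have hφφ : 0 < siteInner φ φ :=
      lt_of_le_of_ne (siteInner_self_nonneg φ) (fun h => hφ (eq_zero_of_siteInner_self_eq_zero φ h.symm))
    exact lt_of_lt_of_le (mul_pos hmsq hφφ) hge
  have hκ : 0 < B1RT.prec (B1.aSeq a P.L k) (P.mesh k) P.d := B1RT.prec_pos (B1.aSeq_pos ha hL hk) (P.mesh_pos k) P.d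
  have hg : (fun φ : ScalarField P 0 N => Real.exp (-(1 / 2 : ℝ) * siteInner φ (delta0 C Ω A msq φ)))
      = gaussDensity (deltaForm C Ω A msq a 0) := by
    funext φ
    rw [gaussDensity, deltaForm_apply, deltaKA_zero]
  unfold renormTransfK
  rw [rtKernelK_eq, hg, ← B1Eq239Normalization.normConst_eq,
    B1Eq221Coordinates.normConst_eq_zConst hκ.le (deltaForm_symm C Ω A msq a 0) hpos]
  exact B1Eq239Normalization.zConst_pos hκ _
    (B1Eq221Coordinates.posDef_coordA (deltaForm_symm C Ω A msq a 0) hpos)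

end Nineteen

end Literature.MathematicalPhysics.QuantumFieldTheory.Balaban1983to89.B1Eq218Model
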